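import Summits.QuantumFields.YangMills.Theorems.UnitScaleTiltProp7CmapTwSymInputs
import Summits.QuantumFields.YangMills.Theorems.UnitScaleTiltProp7SymFrameCovLocality
import HarnessLib

/-!
# Route `UnitScaleTilt`, crux «MinimiserStabilityRegPr» (stmt-QuantumFields-19200, stub EX `stub_existenceMinimalOrbit`), route (α) —
# **THE READ SET OF THE CHART OF RECORD**: `U̿^{twS}(A)(c)`, `log U̿^{twS}(A)(c)`, `Q(U₀)A(c)`, `C(U₀, A)(c)` (✓`Prop7SymAvgTwSymDefs`) and the DERIVATIVE `(δ∕δA)C(U₀,A)(c)`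
# read `A` only on the fine bonds under the two `(K−n)`-blocks of `ĉ = bondShift c` (piece (P2) of LOCATE «W6» px18 g2 — the locality that makes the coarse column of
# `fderiv CmapTwS` an `L`-only constant)

Cell `ym3-torus` (HUMAN RULING D-0037, YM ladder rung R3 — YM₃ on T³ is a rung, NOT d = 4, NOT a mass gap, NOT Clay), width seat `ym3-torus-px18` (gen 2).
THEOREMS ONLY (0 `def`, 0 `sorry`); `--supports stmt-QuantumFields-19200 --as helper`; count-neutral.  Nothing of [Balaban1985Variational] ∕ [Balaban1985Averaging] is
asserted: read-set bookkeeping over ✓`Prop7SymFrameCovLocality` + ✓`Prop8ChartLocality`, and «the derivative of a function constant along a line is zero».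

THE PRINT.  [Balaban1985Variational] p. 289 (72)–(73): «𝔇(A′; c, b) = (δ∕δA(b)) C_j(…)(c) … these kernels are LOCAL: 𝔇(A′; c, b) = 0 unless b ⊂ B^j(c₋) ∪ B^j(c₊)»
(our reading of the locality implicit in (73)'s bound and in [Balaban1985Averaging] (110) p. 34 «the averages depend on the variables in the blocks only»);
[Balaban1985BackgroundPropagators] (3.13)–(3.14) p. 393 (`Q_k(U, ηA) = Q_k(U)A + C_k(U, A)`).

WHAT IS PROVED (sorry-free, no definition; the read predicate is spelled INLINE: `b` is read by `c` iff `B^{K−n}(b₋), B^{K−n}(b₊) ∈ {ĉ₋, ĉ₊}`, `ĉ := bondShift (sites_eq F n K h) c`).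
* §1 `frameTwS_congr_of_agree` (the frame at a comparison site `y` reads the ONE block `B^{K−n}(ŷ)`, ✓`frameAccU_congr_of_agree`), `descendToGL_congr_of_agree`
  (✓`descendToGL_eq_fieldShift_emlIterU` + ✓`emlIterU_congr_of_agree`), ★`dbarTwS_congr_of_agree`, ★`logChartTwS_congr_of_agree`.
* §2 ★★`QTwS_apply_eq_zero_of_vanish_on_reads` — `Q(U₀)δ(c) = 0` when `δ` vanishes on the read set of `c` (the line `t ↦ log U̿^{twS}(t•δ)(c)` is constant;
  `Q(U₀) := fderiv (log U̿^{twS}) 0`, differentiable by ✓`analyticOnNhd_logChartTwS`), hence ★`QTwS_congr_of_agree`, ★`CmapTwS_congr_of_agree`.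
* §3 ★★★`fderiv_CmapTwS_apply_eq_zero_of_vanish_on_reads` — on the analyticity ball `‖A‖ < e·η` of ✓`analyticOnNhd_logChartTwS` (data `10⁹L²e ≤ 1`, `10¹²L³ε₀ ≤ 1`,
  `RegPr F n K ε₀ U₀`): `(fderiv ℂ (CmapTwS U₀) A δ)(c) = 0` when `δ` vanishes on the read set of `c` — the kernel `𝔇(A; c, b)` of (72) VANISHES off the two blocks.
HONEST SCOPE.  Locality only; the per-entry SIZE of the kernel (✓`inputs_CmapTwS`'s `deriv_le`) and the column count are piece (P3).  Nothing here claims EX, the crux,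
d = 4 or the mass gap.

References: T. Bałaban, CMP **102** (1985) 277–309 [Balaban1985Variational] ((44) p.285, (72)–(73) p.289); CMP **98** (1985) 17–51 [Balaban1985Averaging] ((89) p.31,
(97) p.32, (110) p.34, (127) p.36); CMP **99** (1985) 389–434 [Balaban1985BackgroundPropagators] ((3.13)–(3.14) p.393).
-/

set_option autoImplicit false

noncomputable section

namespace Summit.QuantumFields.YangMills.Theorems.Prop7CmapTwSReadSet

open scoped Matrix.Norms.L2Operator
open NormedSpace Metric Set
open Literature.MathematicalPhysics.QuantumFieldTheory.Balaban1983to89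
open Literature.MathematicalPhysics.QuantumFieldTheory.Balaban1983to89.T3ContinuumYM3Torus
open T4Continuum BlockAveraging ExpMeanLog MatrixLog
open T3PrintedRegularMinimiser (RegPr)
open T3PrintedRegularOrbits (sites_eq)
open T3SectALandauChart (eta eta_pos bgUnits)
open T3LevelShift (siteShift bondShift bondShift_src bondShift_tgt fieldShift fieldShift_apply)
open B7Prop1Explicit (expUnit)
open B5Eq118OneStroke (iterBlockOf)
open MatrixLog (mlog)
open Summit.QuantumFields.YangMills.Theorems.Prop8Chart (emlIterU emlIterU_congr_of_agree)
open Summit.QuantumFields.YangMills.Theorems.Prop7SymAvgGL (descendToGL descendToGL_eq_fieldShift_emlIterU)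
open Summit.QuantumFields.YangMills.Theorems.Prop7SymAvgTwSym (frameTwS dbarTwS logChartTwS QTwS CmapTwS)
open Summit.QuantumFields.YangMills.Theorems.Prop7SymFrameCovLocality (frameAccU_congr_of_agree)
open Summit.QuantumFields.YangMills.Theorems.Prop7CmapTwSymInputs (analyticOnNhd_logChartTwS)

variable (F : T3Family) (n K : ℕ) (h : n ≤ K)

/-! ## §1 The twisted double bar and its log read the two blocks of `ĉ` -/

section Values

/-- The tower height `K − n` is within the parameter range of the finest lattice of run `K` (`(F.P K).m = F.m`, `(F.P K).K = K`). [cite: Balaban1985UV3, (1)-(3) p.256] -/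
theorem height_le : K - n ≤ (F.P K).m + (F.P K).K := by
  show K - n ≤ F.m + K
  omega

/-- **THE FRAME AT A COMPARISON SITE READS ONE BLOCK**: `w_A^{sym}(y)` depends on `A` only through the fine bonds `b` with `B^{K−n}(b₋) = B^{K−n}(b₊) = ŷ`,
`ŷ := siteShift (sites_eq F n K h) y`. [cite: Balaban1985Averaging, (97) p.32, (110) p.34] -/
theorem frameTwS_congr_of_agree (U₀ : GaugeField (F.P K) 0 (Matrix.specialUnitaryGroup (Fin 2) ℂ)) {A A' : PBond (F.P K) 0 → Matrix (Fin 2) (Fin 2) ℂ}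
    (y : Site (F.P n) 0)
    (hAA' : ∀ b : PBond (F.P K) 0, iterBlockOf (K - n) b.src = siteShift (sites_eq F n K h) y → iterBlockOf (K - n) b.tgt = siteShift (sites_eq F n K h) y → A b = A' b) :
    frameTwS F n K h U₀ A y = frameTwS F n K h U₀ A' y := by
  unfold frameTwS
  exact frameAccU_congr_of_agree (bgUnits F K U₀) (K - n) (height_le F n K) _ fun b hbs hbt => by rw [hAA' b hbs hbt]

/-- **THE DESCENDED FIELD READS TWO BLOCKS**: `D̄_GL(W)(c) = Ū^{(K−n)}(ĉ)` depends on `W` only through the fine bonds under the two `(K−n)`-blocks of `ĉ`.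
[cite: Balaban1985Averaging, (127) p.36; Balaban1987RG1, (0.4) p.253] -/
theorem descendToGL_congr_of_agree {W W' : GaugeField (F.P K) 0 (Matrix (Fin 2) (Fin 2) ℂ)ˣ} (c : PBond (F.P n) 0)
    (hWW' : ∀ b : PBond (F.P K) 0,
      (iterBlockOf (K - n) b.src = (bondShift (sites_eq F n K h) c).src ∨ iterBlockOf (K - n) b.src = (bondShift (sites_eq F n K h) c).tgt) →
      (iterBlockOf (K - n) b.tgt = (bondShift (sites_eq F n K h) c).src ∨ iterBlockOf (K - n) b.tgt = (bondShift (sites_eq F n K h) c).tgt) → W b = W' b) :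
    descendToGL F n K h W c = descendToGL F n K h W' c := by
  rw [descendToGL_eq_fieldShift_emlIterU, descendToGL_eq_fieldShift_emlIterU, fieldShift_apply, fieldShift_apply]
  exact emlIterU_congr_of_agree (K - n) (height_le F n K) _ hWW'

/-- ★ **THE TWISTED DOUBLE BAR IS TWO-BLOCK LOCAL**: `U̿^{twS}(A)(c)` depends on `A` only through the fine bonds `b` with `B^{K−n}(b₋), B^{K−n}(b₊) ∈ {ĉ₋, ĉ₊}`
(frames at `ĉ₋`, `ĉ₊` read one block each; the descended perturbation reads both; the descended background reads nothing of `A`).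
[cite: Balaban1985Averaging, (89) p.31, (97) p.32, (110) p.34, (127) p.36] -/
theorem dbarTwS_congr_of_agree (U₀ : GaugeField (F.P K) 0 (Matrix.specialUnitaryGroup (Fin 2) ℂ)) {A A' : PBond (F.P K) 0 → Matrix (Fin 2) (Fin 2) ℂ}
    (c : PBond (F.P n) 0)
    (hAA' : ∀ b : PBond (F.P K) 0,
      (iterBlockOf (K - n) b.src = (bondShift (sites_eq F n K h) c).src ∨ iterBlockOf (K - n) b.src = (bondShift (sites_eq F n K h) c).tgt) →
      (iterBlockOf (K - n) b.tgt = (bondShift (sites_eq F n K h) c).src ∨ iterBlockOf (K - n) b.tgt = (bondShift (sites_eq F n K h) c).tgt) → A b = A' b) :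
    dbarTwS F n K h U₀ A c = dbarTwS F n K h U₀ A' c := by
  unfold dbarTwS
  rw [frameTwS_congr_of_agree F n K h U₀ c.src (A := A) (A' := A') fun b hbs hbt => hAA' b (Or.inl hbs) (Or.inl hbt),
    frameTwS_congr_of_agree F n K h U₀ c.tgt (A := A) (A' := A') fun b hbs hbt =>
      hAA' b (Or.inr (by rw [bondShift_tgt]; exact hbs)) (Or.inr (by rw [bondShift_tgt]; exact hbt)),
    descendToGL_congr_of_agree F n K h c (W := fun b => expUnit (A b) * bgUnits F K U₀ b) (W' := fun b => expUnit (A' b) * bgUnits F K U₀ b)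
      fun b hbs hbt => by simp only [hAA' b hbs hbt]]

/-- ★ **THE TWISTED LOG-CHART IS TWO-BLOCK LOCAL** (bondwise `mlog` of the double bar). [cite: Balaban1985BackgroundPropagators, (3.13) p.393; Balaban1985Averaging, (110) p.34] -/
theorem logChartTwS_congr_of_agree (U₀ : GaugeField (F.P K) 0 (Matrix.specialUnitaryGroup (Fin 2) ℂ)) {A A' : PBond (F.P K) 0 → Matrix (Fin 2) (Fin 2) ℂ}
    (c : PBond (F.P n) 0)
    (hAA' : ∀ b : PBond (F.P K) 0,
      (iterBlockOf (K - n) b.src = (bondShift (sites_eq F n K h) c).src ∨ iterBlockOf (K - n) b.src = (bondShift (sites_eq F n K h) c).tgt) →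
      (iterBlockOf (K - n) b.tgt = (bondShift (sites_eq F n K h) c).src ∨ iterBlockOf (K - n) b.tgt = (bondShift (sites_eq F n K h) c).tgt) → A b = A' b) :
    logChartTwS F n K h U₀ A c = logChartTwS F n K h U₀ A' c := by
  show mlog ((dbarTwS F n K h U₀ A c : (Matrix (Fin 2) (Fin 2) ℂ)ˣ) : Matrix (Fin 2) (Fin 2) ℂ) =
    mlog ((dbarTwS F n K h U₀ A' c : (Matrix (Fin 2) (Fin 2) ℂ)ˣ) : Matrix (Fin 2) (Fin 2) ℂ)
  rw [dbarTwS_congr_of_agree F n K h U₀ c hAA']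

end Values

/-! ## §2 The linear part `Q(U₀)` and the remainder `C(U₀, ·)` read the two blocks of `ĉ` -/

section Linear

variable {ε₀ e : ℝ} (hε₀ : 0 < ε₀) (he : 0 < e) (hWe : 10 ^ 9 * (F.L : ℝ) ^ 2 * e ≤ 1) (hWε : 10 ^ 12 * (F.L : ℝ) ^ 3 * ε₀ ≤ 1)
  (U₀ : GaugeField (F.P K) 0 (Matrix.specialUnitaryGroup (Fin 2) ℂ)) (hreg : RegPr F n K ε₀ U₀)

include hε₀ he hWe hWε hreg in
/-- **THE DERIVATIVE OF THE LOG-CHART ALONG A DIRECTION VANISHING ON THE READ SET IS ZERO**, at every point of the analyticity ball: `(fderiv (log U̿^{twS}) A δ)(c) = 0`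
(the line `t ↦ log U̿^{twS}(A + t•δ)(c)` is constant by §1; differentiability from ✓`analyticOnNhd_logChartTwS`). [cite: Balaban1985Variational, (72) p.289; Balaban1985Averaging, (110) p.34] -/
theorem fderiv_logChartTwS_apply_eq_zero_of_vanish_on_reads {A : PBond (F.P K) 0 → Matrix (Fin 2) (Fin 2) ℂ} (hA : ‖A‖ < e * eta F n K)
    (δ : PBond (F.P K) 0 → Matrix (Fin 2) (Fin 2) ℂ) (c : PBond (F.P n) 0)
    (hδ : ∀ b : PBond (F.P K) 0,
      (iterBlockOf (K - n) b.src = (bondShift (sites_eq F n K h) c).src ∨ iterBlockOf (K - n) b.src = (bondShift (sites_eq F n K h) c).tgt) →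
      (iterBlockOf (K - n) b.tgt = (bondShift (sites_eq F n K h) c).src ∨ iterBlockOf (K - n) b.tgt = (bondShift (sites_eq F n K h) c).tgt) → δ b = 0) :
    fderiv ℂ (logChartTwS F n K h U₀) A δ c = 0 := by
  have hd : DifferentiableAt ℂ (logChartTwS F n K h U₀) A :=
    (analyticOnNhd_logChartTwS F h hε₀ he hWe hWε U₀ hreg A (mem_ball_zero_iff.2 hA)).differentiableAt
  -- the line through `A` in the direction `δ`
  have hline : HasDerivAt (fun t : ℂ => A + t • δ) δ 0 := by
    simpa using ((hasDerivAt_id (0 : ℂ)).smul_const δ).const_add A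
  have hA0 : A + (0 : ℂ) • δ = A := by rw [zero_smul, add_zero]
  have hcomp : HasDerivAt (fun t : ℂ => logChartTwS F n K h U₀ (A + t • δ)) (fderiv ℂ (logChartTwS F n K h U₀) A δ) 0 := by
    have hd' : HasFDerivAt (logChartTwS F n K h U₀) (fderiv ℂ (logChartTwS F n K h U₀) A) (A + (0 : ℂ) • δ) := by
      rw [hA0]; exact hd.hasFDerivAt
    exact hd'.comp_hasDerivAt (0 : ℂ) hline
  have hc : HasDerivAt (fun t : ℂ => logChartTwS F n K h U₀ (A + t • δ) c) (fderiv ℂ (logChartTwS F n K h U₀) A δ c) 0 :=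
    (hasDerivAt_pi.1 hcomp) c
  -- … which is constant in `t`
  have hconst : (fun t : ℂ => logChartTwS F n K h U₀ (A + t • δ) c) = fun _ => logChartTwS F n K h U₀ A c := by
    funext t
    exact logChartTwS_congr_of_agree F n K h U₀ c fun b hbs hbt => by rw [Pi.add_apply, Pi.smul_apply, hδ b hbs hbt, smul_zero, add_zero]
  rw [hconst] at hc
  exact hc.unique (hasDerivAt_const (0 : ℂ) _)

include hε₀ he hWe hWε hreg in
/-- ★★ **`Q(U₀)δ (c) = 0` WHEN `δ` VANISHES ON THE READ SET OF `c`** (`Q(U₀) := fderiv (log U̿^{twS}) 0`; §2 at `A = 0`). [cite: Balaban1985BackgroundPropagators, (3.14) p.393; Balaban1985Averaging, (110) p.34] -/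
theorem QTwS_apply_eq_zero_of_vanish_on_reads (δ : PBond (F.P K) 0 → Matrix (Fin 2) (Fin 2) ℂ) (c : PBond (F.P n) 0)
    (hδ : ∀ b : PBond (F.P K) 0,
      (iterBlockOf (K - n) b.src = (bondShift (sites_eq F n K h) c).src ∨ iterBlockOf (K - n) b.src = (bondShift (sites_eq F n K h) c).tgt) →
      (iterBlockOf (K - n) b.tgt = (bondShift (sites_eq F n K h) c).src ∨ iterBlockOf (K - n) b.tgt = (bondShift (sites_eq F n K h) c).tgt) → δ b = 0) :
    QTwS F n K h U₀ δ c = 0 := by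
  have h0 : ‖(0 : PBond (F.P K) 0 → Matrix (Fin 2) (Fin 2) ℂ)‖ < e * eta F n K := by
    rw [norm_zero]; exact mul_pos he (eta_pos F n K)
  unfold QTwS
  exact fderiv_logChartTwS_apply_eq_zero_of_vanish_on_reads F n K h hε₀ he hWe hWε U₀ hreg h0 δ c hδ

include hε₀ he hWe hWε hreg in
/-- ★ **`Q(U₀)` IS TWO-BLOCK LOCAL**: `Q(U₀)A(c) = Q(U₀)A′(c)` when `A = A′` on the read set of `c` (linearity + §2). [cite: Balaban1985BackgroundPropagators, (3.14) p.393] -/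
theorem QTwS_congr_of_agree {A A' : PBond (F.P K) 0 → Matrix (Fin 2) (Fin 2) ℂ} (c : PBond (F.P n) 0)
    (hAA' : ∀ b : PBond (F.P K) 0,
      (iterBlockOf (K - n) b.src = (bondShift (sites_eq F n K h) c).src ∨ iterBlockOf (K - n) b.src = (bondShift (sites_eq F n K h) c).tgt) →
      (iterBlockOf (K - n) b.tgt = (bondShift (sites_eq F n K h) c).src ∨ iterBlockOf (K - n) b.tgt = (bondShift (sites_eq F n K h) c).tgt) → A b = A' b) :
    QTwS F n K h U₀ A c = QTwS F n K h U₀ A' c := by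
  rw [← sub_eq_zero, ← Pi.sub_apply, ← map_sub]
  exact QTwS_apply_eq_zero_of_vanish_on_reads F n K h hε₀ he hWe hWε U₀ hreg (A - A') c fun b hbs hbt => by
    rw [Pi.sub_apply, hAA' b hbs hbt, sub_self]

include hε₀ he hWe hWε hreg in
/-- ★ **THE REMAINDER `C(U₀, A)(c)` IS TWO-BLOCK LOCAL** (`C = log U̿^{twS} − Q`). [cite: Balaban1985Variational, (44) p.285; Balaban1985Averaging, (110) p.34] -/
theorem CmapTwS_congr_of_agree {A A' : PBond (F.P K) 0 → Matrix (Fin 2) (Fin 2) ℂ} (c : PBond (F.P n) 0)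
    (hAA' : ∀ b : PBond (F.P K) 0,
      (iterBlockOf (K - n) b.src = (bondShift (sites_eq F n K h) c).src ∨ iterBlockOf (K - n) b.src = (bondShift (sites_eq F n K h) c).tgt) →
      (iterBlockOf (K - n) b.tgt = (bondShift (sites_eq F n K h) c).src ∨ iterBlockOf (K - n) b.tgt = (bondShift (sites_eq F n K h) c).tgt) → A b = A' b) :
    CmapTwS F n K h U₀ A c = CmapTwS F n K h U₀ A' c := by
  show (logChartTwS F n K h U₀ A - QTwS F n K h U₀ A) c = (logChartTwS F n K h U₀ A' - QTwS F n K h U₀ A') c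
  rw [Pi.sub_apply, Pi.sub_apply, logChartTwS_congr_of_agree F n K h U₀ c hAA', QTwS_congr_of_agree F n K h hε₀ he hWe hWε U₀ hreg c hAA']

/-! ## §3 The kernel of `(δ∕δA)C(U₀, A)` vanishes off the two blocks -/

include hε₀ he hWe hWε hreg in
/-- ★★★ **THE KERNEL `𝔇(A; c, b)` OF (72) VANISHES OFF THE READ SET**: on the analyticity ball `‖A‖ < e·η`, `(fderiv ℂ (C(U₀, ·)) A δ)(c) = 0` whenever `δ` vanishes on the fine
bonds under the two `(K−n)`-blocks of `ĉ` (`C = log U̿^{twS} − Q`: §2 at `A` minus the `A`-independent linear part, §2 at `0`). [cite: Balaban1985Variational, (72)–(73) p.289] -/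
theorem fderiv_CmapTwS_apply_eq_zero_of_vanish_on_reads {A : PBond (F.P K) 0 → Matrix (Fin 2) (Fin 2) ℂ} (hA : ‖A‖ < e * eta F n K)
    (δ : PBond (F.P K) 0 → Matrix (Fin 2) (Fin 2) ℂ) (c : PBond (F.P n) 0)
    (hδ : ∀ b : PBond (F.P K) 0,
      (iterBlockOf (K - n) b.src = (bondShift (sites_eq F n K h) c).src ∨ iterBlockOf (K - n) b.src = (bondShift (sites_eq F n K h) c).tgt) →
      (iterBlockOf (K - n) b.tgt = (bondShift (sites_eq F n K h) c).src ∨ iterBlockOf (K - n) b.tgt = (bondShift (sites_eq F n K h) c).tgt) → δ b = 0) :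
    fderiv ℂ (CmapTwS F n K h U₀) A δ c = 0 := by
  have hd : DifferentiableAt ℂ (logChartTwS F n K h U₀) A :=
    (analyticOnNhd_logChartTwS F h hε₀ he hWe hWε U₀ hreg A (mem_ball_zero_iff.2 hA)).differentiableAt
  have hfun : CmapTwS F n K h U₀ = logChartTwS F n K h U₀ - ⇑(QTwS F n K h U₀) := by
    funext A; rfl
  rw [hfun, fderiv_sub hd (QTwS F n K h U₀).differentiableAt, ContinuousLinearMap.fderiv, sub_apply, Pi.sub_apply,
    fderiv_logChartTwS_apply_eq_zero_of_vanish_on_reads F n K h hε₀ he hWe hWε U₀ hreg hA δ c hδ,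
    QTwS_apply_eq_zero_of_vanish_on_reads F n K h hε₀ he hWe hWε U₀ hreg δ c hδ, sub_zero]

end Linear

end Summit.QuantumFields.YangMills.Theorems.Prop7CmapTwSReadSet

end
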